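import Literature.NumberTheory.LFunctions.WeilPolynomialFromPointCountsPadic
import Literature.NumberTheory.LFunctions.FrobeniusEigenvalueMultiset
import HarnessLib

/-!
# The characteristic polynomial of Frobenius from the point counts (Weil; Mumford §19 Thm. 4, §21) —
# the number-theoretic core of the rigidity route

Topic `NumberTheory/LFunctions`; **proof file**, theorems only (D-0014/D-0026).

**Main theorem** (`FrobeniusRigidity.map_eq_prod_X_sub_C_of_pointCounts`).  Let `p` be a prime, `P ∈ ℤ[X]`
monic of degree `N ≥ 1` with `P(0) ≠ 0`, finitely many `α_i ∈ ℂ` with `|α_i| = c > 1`, and `h : ℕ → ℕ` with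
`h_r = ∏_i (1 - α_i^r)` for `r ≥ 1`.  Suppose that for every prime `ℓ ≠ p` and `r ≥ 1` the `ℓ`-part of `h_r` is
`∏_{P(β)=0} |β^r - 1|_ℓ⁻¹`, and that the `p`-part of `h_r` is `∏_{Q_p(γ)=0} |γ^r - 1|_p⁻¹` for a monic
`Q_p ∈ ℤ_p[X]` whose roots lie among those of `P`.  Then **`P = ∏_i (X - α_i)`** over `ℂ` (in particular
the number of the `α_i` is `N`).

For an abelian variety `A/𝔽_q` (`h_r = #A(𝔽_{q^r})`, `P` = the `ℓ`-independent characteristic polynomial of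
Frobenius on the Tate modules from `Motives/AbelianVarietyFrobeniusCharpolyRigidity`, `α` = the Frobenius
multiset of the zeta function) this is Weil's theorem that the characteristic polynomial of Frobenius on
`T_ℓ A` is the reciprocal numerator of the zeta function — obtained here WITHOUT Mumford §19 Thm. 2
(polynomiality of `deg`).

Proof.  `R_r = Res(P, X^r - 1)` satisfies `|R_r| = h_r p^{a_r}` with `a_r ≥ 0` and `p^{a_r} ≤ p^{v_p(R_r)} ≤ C₀ r^N`
(`WeilPolynomialFromPointCountsPadic`).  Archimedean side: `|R_r| = ∏_β |β^r - 1| ≤ 2^N M^r`,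
`M = ∏ max(1, |β|)`, and on "good" exponents `r` (where the unit-circle roots, none of which is a root of unity,
satisfy `|β^r - 1| ≥ κ`; every window of `N + 1` exponents has one — `exists_good_in_window`)
`|R_r| ≥ κ^N M^r`; with `(c^r - 1)^N ≤ h_r ≤ (c^r + 1)^N` this gives first `M ≤ c^N` (exponential versus
polynomial growth) and then `|R_r| ≤ C h_r` for all `r`.  The tower argument of the `p`-adic file then yields
`a_r = 0`, i.e. `R_r = ± h_r`, so `(∏_β (1 - β^r))² = (∏_i (1 - α_i^r))²` for all `r ≥ 1`; applying
`FrobeniusMultiset.univ_val_map_eq` to the DOUBLED families gives `2·{β} = 2·{α}` as multisets, whence the claim.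

## References

* [MumfordAV1970] D. Mumford, *Abelian Varieties* (1970), §19 Thm. 4, §21 (the statement served).
* [Milne1986AbelianVarieties] J. S. Milne, *Abelian Varieties*, in Cornell–Silverman (1986), Thm. 19.1.
The route itself (resultants, `p`-adic rigidity, exponent windows) is elementary. [folklore]

## Design

Mathlib (pin, used): `tendsto_pow_const_div_const_pow_of_one_lt`, `pow_unbounded_of_one_lt`,
`exists_pow_lt_of_lt_one`, `Finset.exists_ne_map_eq_of_card_lt_of_maps_to`, `Finset.inf'`,
`Multiset.prod_map_le_prod_map₀`, `Multiset.map_univ` (the coercion of a multiset to a type),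
`prod_multiset_X_sub_C_of_monic_of_roots_card_eq`, `Int.natAbs_eq_iff`.  In the tree (used):
`FrobeniusRigidity.*` of `WeilPolynomialFromPointCountsPadic`, `FrobeniusMultiset.univ_val_map_eq`.
-/

noncomputable section

open Polynomial Finset Filter
open scoped Classical Topology

namespace Literature.NumberTheory.LFunctions

namespace FrobeniusRigidity

open Literature.Algebra.Polynomial Literature.Algebra.Polynomial.RootRigidity

/-! ### Archimedean estimates for `∏ |β^r - 1|` -/

/-- `|b^r - 1| ≤ 2 · max(1, |b|)^r`. [folklore] -/
theorem norm_pow_sub_one_le (b : ℂ) (r : ℕ) : ‖b ^ r - 1‖ ≤ 2 * max 1 ‖b‖ ^ r := by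
  have h1 : (1 : ℝ) ≤ max 1 ‖b‖ ^ r := one_le_pow₀ (le_max_left _ _)
  calc ‖b ^ r - 1‖ ≤ ‖b ^ r‖ + ‖(1 : ℂ)‖ := norm_sub_le _ _
    _ ≤ max 1 ‖b‖ ^ r + max 1 ‖b‖ ^ r := by
        rw [norm_pow, norm_one]
        exact add_le_add (pow_le_pow_left₀ (norm_nonneg _) (le_max_right _ _) r) h1
    _ = 2 * max 1 ‖b‖ ^ r := by ring

/-- `∏_{b ∈ B} |b^r - 1| ≤ 2^{#B} · M^r` with `M = ∏_{b ∈ B} max(1, |b|)`. [folklore] -/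
theorem prod_norm_pow_sub_one_le (B : Multiset ℂ) (r : ℕ) :
    (B.map fun b => ‖b ^ r - 1‖).prod ≤ 2 ^ Multiset.card B * ((B.map fun b => max 1 ‖b‖).prod) ^ r := by
  calc (B.map fun b => ‖b ^ r - 1‖).prod ≤ (B.map fun b => 2 * max 1 ‖b‖ ^ r).prod :=
        Multiset.prod_map_le_prod_map₀ _ _ (fun b _ => norm_nonneg _) fun b _ => norm_pow_sub_one_le b r
    _ = 2 ^ Multiset.card B * ((B.map fun b => max 1 ‖b‖).prod) ^ r := by
        rw [Multiset.prod_map_mul, Multiset.map_const', Multiset.prod_replicate, Multiset.prod_map_pow]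

/-- `1 ≤ M = ∏ max(1, |b|)`. [folklore] -/
theorem one_le_prod_max (B : Multiset ℂ) : 1 ≤ (B.map fun b => max 1 ‖b‖).prod := by
  induction B using Multiset.induction_on with
  | empty => simp
  | cons a s ih =>
    rw [Multiset.map_cons, Multiset.prod_cons]
    exact one_le_mul_of_one_le_of_one_le (le_max_left _ _) ih

/-- `(c^r - 1)^N ≤ ∏_i |1 - α_i^r| ≤ (c^r + 1)^N` for `|α_i| = c`. [folklore] -/
theorem pow_le_prod_norm_one_sub_pow {ι : Type*} [Fintype ι] {α : ι → ℂ} {c : ℝ} (hc : 1 ≤ c)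
    (hα : ∀ i, ‖α i‖ = c) (r : ℕ) :
    (c ^ r - 1) ^ Fintype.card ι ≤ ∏ i, ‖1 - α i ^ r‖ ∧ ∏ i, ‖1 - α i ^ r‖ ≤ (c ^ r + 1) ^ Fintype.card ι := by
  have hcr : (1 : ℝ) ≤ c ^ r := one_le_pow₀ hc
  constructor
  · calc (c ^ r - 1) ^ Fintype.card ι = ∏ _i : ι, (c ^ r - 1) := by rw [Finset.prod_const, Finset.card_univ]
      _ ≤ ∏ i, ‖1 - α i ^ r‖ := by
          refine Finset.prod_le_prod (fun i _ => by linarith) fun i _ => ?_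
          calc c ^ r - 1 = ‖α i ^ r‖ - ‖(1 : ℂ)‖ := by rw [norm_pow, hα, norm_one]
            _ ≤ ‖α i ^ r - 1‖ := norm_sub_norm_le _ _
            _ = ‖1 - α i ^ r‖ := norm_sub_rev _ _
  · calc ∏ i, ‖1 - α i ^ r‖ ≤ ∏ _i : ι, (c ^ r + 1) := by
          refine Finset.prod_le_prod (fun i _ => norm_nonneg _) fun i _ => ?_
          calc ‖1 - α i ^ r‖ ≤ ‖(1 : ℂ)‖ + ‖α i ^ r‖ := norm_sub_le _ _
            _ = c ^ r + 1 := by rw [norm_pow, hα, norm_one, add_comm]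
      _ = (c ^ r + 1) ^ Fintype.card ι := by rw [Finset.prod_const, Finset.card_univ]

/-- `∏_i (1 - α_i^r) ≠ 0` for `|α_i| = c > 1` and `r ≥ 1`. [folklore] -/
theorem prod_one_sub_pow_ne_zero {ι : Type*} [Fintype ι] {α : ι → ℂ} {c : ℝ} (hc : 1 < c) (hα : ∀ i, ‖α i‖ = c)
    {r : ℕ} (hr : 0 < r) : ∏ i, (1 - α i ^ r) ≠ 0 := by
  rw [Finset.prod_ne_zero_iff]
  intro i _ h
  have h1 : ‖α i ^ r‖ = 1 := by rw [(sub_eq_zero.mp h).symm, norm_one]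
  rw [norm_pow, hα] at h1
  have : (1 : ℝ) < c ^ r := one_lt_pow₀ hc hr.ne'
  linarith

/-! ### Growth lemmas -/

/-- Exponential beats polynomial: `K · r^N < x^r` for `r` large (`x > 1`). [folklore] -/
theorem exists_forall_mul_pow_lt_pow {x : ℝ} (hx : 1 < x) (K : ℝ) (N : ℕ) :
    ∃ r₂ : ℕ, ∀ r : ℕ, r₂ ≤ r → K * (r : ℝ) ^ N < x ^ r := by
  by_cases hK : K ≤ 0
  · exact ⟨0, fun r _ => (mul_nonpos_of_nonpos_of_nonneg hK (by positivity)).trans_lt (pow_pos (by linarith) r)⟩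
  push Not at hK
  have h := tendsto_pow_const_div_const_pow_of_one_lt N hx
  have hev : ∀ᶠ n : ℕ in atTop, (n : ℝ) ^ N / x ^ n < K⁻¹ := h.eventually (gt_mem_nhds (inv_pos.mpr hK))
  obtain ⟨r₂, hr₂⟩ := eventually_atTop.mp hev
  refine ⟨r₂, fun r hr => ?_⟩
  have hxr : (0 : ℝ) < x ^ r := pow_pos (by linarith) r
  have h1 := hr₂ r hr
  rw [div_lt_iff₀ hxr] at h1
  calc K * (r : ℝ) ^ N < K * (K⁻¹ * x ^ r) := mul_lt_mul_of_pos_left h1 hK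
    _ = x ^ r := by rw [← mul_assoc, mul_inv_cancel₀ hK.ne', one_mul]

/-- `y ≤ x^r` for `r` large (`x > 1`). [folklore] -/
theorem exists_forall_le_pow {x : ℝ} (hx : 1 < x) (y : ℝ) : ∃ r₁ : ℕ, ∀ r : ℕ, r₁ ≤ r → y ≤ x ^ r := by
  obtain ⟨n, hn⟩ := pow_unbounded_of_one_lt y hx
  exact ⟨n, fun r hr => hn.le.trans (pow_le_pow_right₀ hx.le hr)⟩

/-- `x^r ≤ y` for `r` large (`0 ≤ x < 1`, `y > 0`). [folklore] -/
theorem exists_forall_pow_le {x : ℝ} (hx0 : 0 ≤ x) (hx : x < 1) {y : ℝ} (hy : 0 < y) :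
    ∃ r₁ : ℕ, ∀ r : ℕ, r₁ ≤ r → x ^ r ≤ y := by
  obtain ⟨n, hn⟩ := exists_pow_lt_of_lt_one hy hx
  exact ⟨n, fun r hr => (pow_le_pow_of_le_one hx0 hx.le hr).trans hn.le⟩

/-! ### Windows of good exponents for the unit-circle roots -/

/-- **Good exponents in every window.**  For finitely many complex numbers of absolute value `1`, none a root of
unity, there is `c > 0` such that every window of `#U + 1` consecutive exponents contains an `r` with
`|u^r - 1| ≥ c` for all `u ∈ U`: with `2c = min_{u, 1 ≤ d ≤ #U} |u^d - 1|`, each `u` spoils at most one exponent per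
window (`|u^{r'} - u^r| = |u^{r'-r} - 1| ≥ 2c`). [folklore] -/
theorem exists_good_in_window (U : Finset ℂ) (hU1 : ∀ u ∈ U, ‖u‖ = 1)
    (hU : ∀ u ∈ U, ∀ n : ℕ, 0 < n → u ^ n ≠ 1) :
    ∃ c : ℝ, 0 < c ∧ ∀ r₀ : ℕ, ∃ r : ℕ, r₀ ≤ r ∧ r ≤ r₀ + U.card ∧ ∀ u ∈ U, c ≤ ‖u ^ r - 1‖ := by
  by_cases hUe : U = ∅
  · refine ⟨1, one_pos, fun r₀ => ⟨r₀, le_rfl, Nat.le_add_right _ _, fun u hu => ?_⟩⟩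
    rw [hUe] at hu; exact absurd hu (Finset.notMem_empty u)
  set m := U.card with hm
  have hm1 : 1 ≤ m := Finset.card_pos.mpr (Finset.nonempty_iff_ne_empty.mpr hUe)
  set S := U ×ˢ Finset.Icc 1 m with hS
  have hSne : S.Nonempty := by
    obtain ⟨u, hu⟩ := Finset.nonempty_iff_ne_empty.mpr hUe
    exact ⟨(u, 1), Finset.mem_product.mpr ⟨hu, Finset.mem_Icc.mpr ⟨le_rfl, hm1⟩⟩⟩
  set μ := S.inf' hSne (fun x => ‖x.1 ^ x.2 - 1‖) with hμ
  have hμpos : 0 < μ := by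
    rw [hμ, Finset.lt_inf'_iff]
    intro x hx
    obtain ⟨hu, hd⟩ := Finset.mem_product.mp hx
    rw [norm_pos_iff, sub_ne_zero]
    exact hU x.1 hu x.2 (Finset.mem_Icc.mp hd).1
  have hμle : ∀ u ∈ U, ∀ d : ℕ, 1 ≤ d → d ≤ m → μ ≤ ‖u ^ d - 1‖ := by
    intro u hu d hd1 hdm
    have hmem : (u, d) ∈ S := Finset.mem_product.mpr ⟨hu, Finset.mem_Icc.mpr ⟨hd1, hdm⟩⟩
    exact Finset.inf'_le (fun x : ℂ × ℕ => ‖x.1 ^ x.2 - 1‖) hmem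
  refine ⟨μ / 2, by positivity, fun r₀ => ?_⟩
  by_contra hbad
  push Not at hbad
  -- every `r` in the window is spoiled by some `u`
  have hsp : ∀ r ∈ Finset.Icc r₀ (r₀ + m), ∃ u ∈ U, ‖u ^ r - 1‖ < μ / 2 := by
    intro r hr
    obtain ⟨hr1, hr2⟩ := Finset.mem_Icc.mp hr
    obtain ⟨u, hu, hlt⟩ := hbad r hr1 hr2
    exact ⟨u, hu, hlt⟩
  choose! f hfU hflt using hsp
  have hcard : U.card < (Finset.Icc r₀ (r₀ + m)).card := by
    rw [Nat.card_Icc]; omega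
  obtain ⟨r, hr, r', hr', hne, hfeq⟩ := Finset.exists_ne_map_eq_of_card_lt_of_maps_to hcard hfU
  -- WLOG `r < r'`
  have key : ∀ {r r' : ℕ}, r ∈ Finset.Icc r₀ (r₀ + m) → r' ∈ Finset.Icc r₀ (r₀ + m) → r < r' → f r = f r' → False := by
    intro r r' hr hr' hlt hfeq
    have h1 : ‖f r ^ r - 1‖ < μ / 2 := hflt r hr
    have h2 : ‖f r ^ r' - 1‖ < μ / 2 := by rw [hfeq]; exact hflt r' hr'
    set u := f r with hu
    have hu1 : ‖u‖ = 1 := hU1 u (hfU r hr)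
    obtain ⟨hra, hrb⟩ := Finset.mem_Icc.mp hr
    obtain ⟨hra', hrb'⟩ := Finset.mem_Icc.mp hr'
    have hd : μ ≤ ‖u ^ (r' - r) - 1‖ := hμle u (hfU r hr) (r' - r) (by omega) (by omega)
    have hid : u ^ r' - u ^ r = u ^ r * (u ^ (r' - r) - 1) := by
      rw [mul_sub, mul_one, ← pow_add, Nat.add_sub_cancel' hlt.le]
    have h3 : ‖u ^ r' - u ^ r‖ < μ := by
      calc ‖u ^ r' - u ^ r‖ = ‖(u ^ r' - 1) - (u ^ r - 1)‖ := by ring_nf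
        _ ≤ ‖u ^ r' - 1‖ + ‖u ^ r - 1‖ := norm_sub_le _ _
        _ < μ / 2 + μ / 2 := add_lt_add h2 h1
        _ = μ := by ring
    rw [hid, norm_mul, norm_pow, hu1, one_pow, one_mul] at h3
    exact absurd hd (not_le.mpr h3)
  rcases lt_or_gt_of_ne hne with hlt | hlt
  · exact key hr hr' hlt hfeq
  · exact key hr' hr hlt hfeq.symm

/-! ### The lower bound on good exponents -/

/-- **`κ^{#B} M^r ≤ ∏_{b ∈ B} |b^r - 1|` for large good `r`**: for `r ≥ r₁` every root off the unit circle
contributes at least `max(1,|b|)^r / 2`, and on a good exponent every unit-circle root contributes at least `κ`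
(`κ ≤ 1/2`). [folklore] -/
theorem exists_forall_pow_mul_pow_le_prod (B : Multiset ℂ) :
    ∃ r₁ : ℕ, ∀ r : ℕ, r₁ ≤ r → ∀ κ : ℝ, 0 ≤ κ → κ ≤ 1 / 2 →
      (∀ b ∈ B, ‖b‖ = 1 → κ ≤ ‖b ^ r - 1‖) →
      κ ^ Multiset.card B * ((B.map fun b => max 1 ‖b‖).prod) ^ r ≤ (B.map fun b => ‖b ^ r - 1‖).prod := by
  -- thresholds for the roots off the unit circle
  have hthr : ∀ b : ℂ, ∃ rb : ℕ, ∀ r : ℕ, rb ≤ r →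
      (1 < ‖b‖ → (2 : ℝ) ≤ ‖b‖ ^ r) ∧ (‖b‖ < 1 → ‖b‖ ^ r ≤ 1 / 2) := by
    intro b
    rcases lt_trichotomy ‖b‖ 1 with hlt | heq | hgt
    · obtain ⟨rb, hrb⟩ := exists_forall_pow_le (norm_nonneg b) hlt (by norm_num : (0 : ℝ) < 1 / 2)
      exact ⟨rb, fun r hr => ⟨fun h => absurd hlt (not_lt.mpr h.le), fun _ => hrb r hr⟩⟩
    · exact ⟨0, fun r _ => ⟨fun h => absurd heq h.ne', fun h => absurd heq h.ne⟩⟩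
    · obtain ⟨rb, hrb⟩ := exists_forall_le_pow hgt 2
      exact ⟨rb, fun r hr => ⟨fun _ => hrb r hr, fun h => absurd hgt (not_lt.mpr h.le)⟩⟩
  choose rb hrb using hthr
  refine ⟨B.toFinset.sup rb, fun r hr κ hκ0 hκ hgood => ?_⟩
  have hfac : ∀ b ∈ B, κ * max 1 ‖b‖ ^ r ≤ ‖b ^ r - 1‖ := by
    intro b hb
    have hrb' : rb b ≤ r := (Finset.le_sup (Multiset.mem_toFinset.mpr hb)).trans hr
    obtain ⟨hbig, hsmall⟩ := hrb b r hrb'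
    rcases lt_trichotomy ‖b‖ 1 with hlt | heq | hgt
    · rw [max_eq_left hlt.le, one_pow, mul_one]
      have h1 := hsmall hlt
      calc κ ≤ 1 / 2 := hκ
        _ ≤ 1 - ‖b‖ ^ r := by linarith
        _ = ‖(1 : ℂ)‖ - ‖b ^ r‖ := by rw [norm_one, norm_pow]
        _ ≤ ‖1 - b ^ r‖ := norm_sub_norm_le _ _
        _ = ‖b ^ r - 1‖ := norm_sub_rev _ _
    · rw [heq, max_self, one_pow, mul_one]
      exact hgood b hb heq
    · rw [max_eq_right hgt.le]
      have h1 := hbig hgt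
      calc κ * ‖b‖ ^ r ≤ 1 / 2 * ‖b‖ ^ r := mul_le_mul_of_nonneg_right hκ (by positivity)
        _ ≤ ‖b‖ ^ r - 1 := by linarith
        _ = ‖b ^ r‖ - ‖(1 : ℂ)‖ := by rw [norm_pow, norm_one]
        _ ≤ ‖b ^ r - 1‖ := norm_sub_norm_le _ _
  calc κ ^ Multiset.card B * ((B.map fun b => max 1 ‖b‖).prod) ^ r = (B.map fun b => κ * max 1 ‖b‖ ^ r).prod := by
        rw [Multiset.prod_map_mul, Multiset.map_const', Multiset.prod_replicate, Multiset.prod_map_pow]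
    _ ≤ (B.map fun b => ‖b ^ r - 1‖).prod :=
        Multiset.prod_map_le_prod_map₀ _ _ (fun b _ => by positivity) hfac

/-! ### Multiset bookkeeping for the doubling trick -/

/-- `univ.map (Sum.elim f g) = univ.map f + univ.map g` as multisets. [folklore] -/
theorem univ_val_map_sum_elim {X Y : Type*} [Fintype X] [Fintype Y] (f : X → ℂ) (g : Y → ℂ) :
    (univ : Finset (X ⊕ Y)).val.map (Sum.elim f g) = (univ : Finset X).val.map f + (univ : Finset Y).val.map g := by
  rw [← Finset.univ_disjSum_univ]
  change ((univ : Finset X).val.disjSum (univ : Finset Y).val).map _ = _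
  rw [Multiset.disjSum, Multiset.map_add, Multiset.map_map, Multiset.map_map, Sum.elim_comp_inl,
    Sum.elim_comp_inr]

/-- Halving a multiset identity: `s + s = t + t → s = t`. [folklore] -/
theorem eq_of_add_self_eq_add_self {s t : Multiset ℂ} (h : s + s = t + t) : s = t := by
  refine Multiset.ext.mpr fun z => ?_
  have := congrArg (Multiset.count z) h
  rw [Multiset.count_add, Multiset.count_add] at this
  omega

/-! ### The main theorem -/

/-- **The characteristic polynomial of Frobenius from the point counts** (Weil; Mumford §19 Thm. 4, §21;
Milne 1986 Thm. 19.1 — number-theoretic core of the tree's rigidity route, see the module docstring).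
Let `P ∈ ℤ[X]` be monic of degree `N ≥ 1` with `P(0) ≠ 0`, `|α_i| = c > 1` (`i ∈ ι` finite), `h_r = ∏_i (1 - α_i^r)`
(`r ≥ 1`); assume the `ℓ`-parts of `h_r` are `kerNorm_ℓ(P, X^r - 1)` for all primes `ℓ ≠ p` and the `p`-part is
`kerNorm_p(Q_p, X^r - 1)` for a monic `Q_p ∈ ℤ_p[X]` with roots among those of `P`.  Then `P = ∏_i (X - α_i)` in
`ℂ[X]`. [cite: MumfordAV1970, §19 Thm. 4 with §21; Milne1986AbelianVarieties, Thm. 19.1] -/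
theorem map_eq_prod_X_sub_C_of_pointCounts (p : ℕ) [hp : Fact p.Prime] {P : ℤ[X]} (hP : P.Monic) {N : ℕ}
    (hPN : P.natDegree = N) (hN : 0 < N) (hP0 : P.coeff 0 ≠ 0) {c : ℝ} (hc : 1 < c) {ι : Type*} [Fintype ι]
    {α : ι → ℂ} (hα : ∀ i, ‖α i‖ = c) {h : ℕ → ℕ}
    (hhα : ∀ r : ℕ, 0 < r → ((h r : ℕ) : ℂ) = ∏ i, (1 - α i ^ r))
    (hℓ : ∀ (ℓ : ℕ) [Fact ℓ.Prime], ℓ ≠ p → ∀ r : ℕ, 0 < r →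
      ((ℓ : ℝ) ^ ((h r).factorization ℓ)) = kerNorm (P.map (Int.castRingHom ℤ_[ℓ])) (X ^ r - 1))
    {Qp : ℤ_[p][X]}
    (hle : (Qp.map (algebraMap ℤ_[p] (PadicAlgCl p))).roots ≤
      ((P.map (Int.castRingHom ℤ_[p])).map (algebraMap ℤ_[p] (PadicAlgCl p))).roots)
    (hpv : ∀ r : ℕ, 0 < r → ((p : ℝ) ^ ((h r).factorization p)) = kerNorm Qp (X ^ r - 1)) :
    P.map (algebraMap ℤ ℂ) = ∏ i, (X - C (α i)) := by
  -- notation: the complex roots `B`, `M = ∏ max(1, |β|)`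
  set B := (P.map (algebraMap ℤ ℂ)).roots with hB
  have hPm : (P.map (algebraMap ℤ ℂ)).Monic := hP.map _
  have hcard' : Multiset.card (P.map (algebraMap ℤ ℂ)).roots = (P.map (algebraMap ℤ ℂ)).natDegree :=
    ((IsAlgClosed.splits _).natDegree_eq_card_roots).symm
  have hcardB : Multiset.card B = N := by rw [hB, hcard', hP.natDegree_map, hPN]
  set M := (B.map fun b => max 1 ‖b‖).prod with hM
  have hM1 : 1 ≤ M := one_le_prod_max B
  -- `h_r ≠ 0`, and `h_r = ∏ |1 - α_i^r|` as a real number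
  have hh0 : ∀ r : ℕ, 0 < r → h r ≠ 0 := by
    intro r hr h0
    have h1 := hhα r hr
    rw [h0, Nat.cast_zero] at h1
    exact prod_one_sub_pow_ne_zero hc hα hr h1.symm
  have hhr : ∀ r : ℕ, 0 < r → (h r : ℝ) = ∏ i, ‖1 - α i ^ r‖ := by
    intro r hr
    have h1 := congrArg (fun z : ℂ => ‖z‖) (hhα r hr)
    simp only [Complex.norm_natCast, norm_prod] at h1
    exact h1
  -- the resultants in `ℂ`
  have hRC : ∀ r : ℕ, 0 < r →
      ((Polynomial.resultant P (X ^ r - 1) N r : ℤ) : ℂ) = (B.map fun b => b ^ r - 1).prod := by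
    intro r hr
    have h1 := algebraMap_resultant_X_pow_sub_one (L := ℂ) hP hPN hr
    rw [← hB] at h1
    rw [← h1]
    simp
  have hRabs : ∀ r : ℕ, 0 < r →
      ((Polynomial.resultant P (X ^ r - 1) N r).natAbs : ℝ) = (B.map fun b => ‖b ^ r - 1‖).prod := by
    intro r hr
    have h1 : ((Polynomial.resultant P (X ^ r - 1) N r).natAbs : ℝ) =
        ‖((Polynomial.resultant P (X ^ r - 1) N r : ℤ) : ℂ)‖ := by
      rw [Complex.norm_intCast, Nat.cast_natAbs, Int.cast_abs]
    rw [h1, hRC r hr]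
    change (normHom : ℂ →*₀ ℝ) _ = _
    rw [map_multiset_prod, Multiset.map_map]
    rfl
  -- the `p`-adic input
  have hmain := fun r (hr : 0 < r) =>
    natAbs_resultant_eq_mul_div (p := p) hP hPN hr (hh0 r hr) (fun ℓ _ hne => hℓ ℓ hne r hr) hle (hpv r hr)
  have hR : ∀ r : ℕ, 0 < r → Polynomial.resultant P (X ^ r - 1) N r ≠ 0 := fun r hr => (hmain r hr).1
  obtain ⟨C₀, hC₀, hC₀b⟩ := exists_pow_padicValInt_resultant_le (p := p) hP hPN hR
  have hp1 : (1 : ℝ) ≤ p := by exact_mod_cast hp.out.one_lt.le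
  -- KEY UPPER BOUND: `|R_r| ≤ h_r · C₀ r^N`
  have hupper : ∀ r : ℕ, 0 < r →
      ((Polynomial.resultant P (X ^ r - 1) N r).natAbs : ℝ) ≤ h r * (C₀ * (r : ℝ) ^ N) := by
    intro r hr
    obtain ⟨-, -, ⟨a, ha, hquot⟩, hid⟩ := hmain r hr
    rw [hid, hquot]
    refine mul_le_mul_of_nonneg_left ?_ (Nat.cast_nonneg _)
    exact (pow_le_pow_right₀ hp1 ha).trans (hC₀b r hr)
  -- no complex root of `P` is a root of unity
  have hBunit : ∀ b ∈ B, ∀ n : ℕ, 0 < n → b ^ n ≠ 1 := fun b hb n hn =>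
    pow_ne_one_of_resultant_ne_zero (L := ℂ) hP hPN hn (hR n hn) (by rw [hB] at hb; exact hb)
  -- windows of good exponents for the unit-circle roots
  set U := B.toFinset.filter (fun b => ‖b‖ = 1) with hU
  obtain ⟨cw, hcw, hwin⟩ := exists_good_in_window U (fun u hu => (Finset.mem_filter.mp hu).2)
    (fun u hu n hn => hBunit u (Multiset.mem_toFinset.mp (Finset.mem_filter.mp hu).1) n hn)
  set κ := min cw (1 / 2) with hκ
  have hκ0 : 0 < κ := lt_min hcw (by norm_num)
  have hκ2 : κ ≤ 1 / 2 := min_le_right _ _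
  obtain ⟨r₁, hr₁⟩ := exists_forall_pow_mul_pow_le_prod B
  have hlower : ∀ r : ℕ, r₁ ≤ r → (∀ u ∈ U, cw ≤ ‖u ^ r - 1‖) →
      κ ^ N * M ^ r ≤ (B.map fun b => ‖b ^ r - 1‖).prod := by
    intro r hr hgood
    have h1 := hr₁ r hr κ hκ0.le hκ2 (fun b hb hb1 => (min_le_left _ _).trans
      (hgood b (Finset.mem_filter.mpr ⟨Multiset.mem_toFinset.mpr hb, hb1⟩)))
    rwa [hcardB] at h1
  -- STEP `M ≤ c^{N'}` (`N' = #ι`): otherwise exponential growth on good exponents beats the polynomial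
  -- `p`-adic bound
  set N' := Fintype.card ι with hN'
  have hMc : M ≤ c ^ N' := by
    by_contra hlt
    push Not at hlt
    have hcN : 0 < c ^ N' := by positivity
    set x := M / c ^ N' with hx
    have hx1 : 1 < x := (one_lt_div hcN).mpr hlt
    obtain ⟨r₂, hr₂⟩ := exists_forall_mul_pow_lt_pow hx1 (2 ^ N' * C₀ / κ ^ N) N
    obtain ⟨r, hr0, -, hgood⟩ := hwin (max r₁ r₂ + 1)
    have hrpos : 0 < r := by omega
    have hr1' : r₁ ≤ r := by omega
    have hr2' : r₂ ≤ r := by omega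
    have h1 := hlower r hr1' hgood
    have h2 := hupper r hrpos
    rw [hRabs r hrpos] at h2
    have h3 : (h r : ℝ) ≤ (2 * c ^ r) ^ N' := by
      rw [hhr r hrpos]
      refine (pow_le_prod_norm_one_sub_pow hc.le hα r).2.trans ?_
      apply pow_le_pow_left₀ (by positivity)
      have : (1 : ℝ) ≤ c ^ r := one_le_pow₀ hc.le
      linarith
    have h4 : κ ^ N * M ^ r ≤ (2 * c ^ r) ^ N' * (C₀ * (r : ℝ) ^ N) :=
      h1.trans (h2.trans (mul_le_mul_of_nonneg_right h3 (by positivity)))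
    have hκN : 0 < κ ^ N := pow_pos hκ0 N
    have h5 : x ^ r ≤ 2 ^ N' * C₀ / κ ^ N * (r : ℝ) ^ N := by
      rw [hx, div_pow, div_le_iff₀ (pow_pos hcN r)]
      calc M ^ r = (κ ^ N)⁻¹ * (κ ^ N * M ^ r) := by rw [← mul_assoc, inv_mul_cancel₀ hκN.ne', one_mul]
        _ ≤ (κ ^ N)⁻¹ * ((2 * c ^ r) ^ N' * (C₀ * (r : ℝ) ^ N)) :=
            mul_le_mul_of_nonneg_left h4 (inv_nonneg.mpr hκN.le)
        _ = 2 ^ N' * C₀ / κ ^ N * (r : ℝ) ^ N * (c ^ N') ^ r := by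
            rw [mul_pow, ← pow_mul, ← pow_mul, mul_comm r N', div_eq_mul_inv]; ring
    exact absurd (hr₂ r hr2') (not_lt.mpr h5)
  -- STEP `|R_r| ≤ C h_r` for all `r ≥ 1`
  obtain ⟨r₃, hr₃⟩ := exists_forall_le_pow hc 2
  have hbound : ∀ r : ℕ, 0 < r → ((Polynomial.resultant P (X ^ r - 1) N r).natAbs : ℝ) ≤
      (2 ^ N * 2 ^ N' + 2 ^ N * (c ^ N') ^ r₃) * h r := by
    intro r hr
    have hh1 : (1 : ℝ) ≤ h r := by exact_mod_cast Nat.one_le_iff_ne_zero.mpr (hh0 r hr)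
    have hup : ((Polynomial.resultant P (X ^ r - 1) N r).natAbs : ℝ) ≤ 2 ^ N * (c ^ N') ^ r := by
      rw [hRabs r hr]
      refine (prod_norm_pow_sub_one_le B r).trans ?_
      rw [hcardB]
      exact mul_le_mul_of_nonneg_left (pow_le_pow_left₀ (by linarith) hMc r) (by positivity)
    rcases le_or_gt r₃ r with hr3 | hr3
    · have hcr : (2 : ℝ) ≤ c ^ r := hr₃ r hr3
      have hlow : (c ^ r / 2) ^ N' ≤ h r := by
        rw [hhr r hr]
        refine le_trans ?_ (pow_le_prod_norm_one_sub_pow hc.le hα r).1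
        exact pow_le_pow_left₀ (by positivity) (by linarith) N'
      calc ((Polynomial.resultant P (X ^ r - 1) N r).natAbs : ℝ) ≤ 2 ^ N * (c ^ N') ^ r := hup
        _ = 2 ^ N * 2 ^ N' * (c ^ r / 2) ^ N' := by
            rw [div_pow, ← pow_mul, ← pow_mul, mul_comm N' r]
            field_simp
        _ ≤ 2 ^ N * 2 ^ N' * h r := mul_le_mul_of_nonneg_left hlow (by positivity)
        _ ≤ (2 ^ N * 2 ^ N' + 2 ^ N * (c ^ N') ^ r₃) * h r :=
            mul_le_mul_of_nonneg_right (le_add_of_nonneg_right (by positivity)) (by positivity)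
    · calc ((Polynomial.resultant P (X ^ r - 1) N r).natAbs : ℝ) ≤ 2 ^ N * (c ^ N') ^ r := hup
        _ ≤ 2 ^ N * (c ^ N') ^ r₃ :=
            mul_le_mul_of_nonneg_left (pow_le_pow_right₀ (one_le_pow₀ hc.le) hr3.le) (by positivity)
        _ ≤ (2 ^ N * (c ^ N') ^ r₃) * h r := le_mul_of_one_le_right (by positivity) hh1
        _ ≤ (2 ^ N * 2 ^ N' + 2 ^ N * (c ^ N') ^ r₃) * h r :=
            mul_le_mul_of_nonneg_right (le_add_of_nonneg_left (by positivity)) (by positivity)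
  -- STEP `a_r = 0`: the tower argument
  have hnat := natAbs_resultant_eq_of_bounded (p := p) hP hPN hN hh0 hℓ hle hpv hbound
  -- STEP the squares identity `(∏_β (1 - β^r))² = (∏_i (1 - α_i^r))²`
  have hsq : ∀ r : ℕ, 0 < r → ((B.map fun b => 1 - b ^ r).prod) ^ 2 = (∏ i, (1 - α i ^ r)) ^ 2 := by
    intro r hr
    have h1 : (((Polynomial.resultant P (X ^ r - 1) N r : ℤ) : ℂ)) ^ 2 = (((h r : ℕ) : ℂ)) ^ 2 := by
      rcases Int.natAbs_eq_iff.mp (hnat r hr) with h' | h'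
      · rw [h']; push_cast; ring
      · rw [h']; push_cast; ring
    rw [hRC r hr, hhα r hr] at h1
    rw [← h1]
    have h2 : (B.map fun b => b ^ r - 1).prod = (-1) ^ Multiset.card B * (B.map fun b => 1 - b ^ r).prod := by
      rw [← Multiset.prod_replicate, ← Multiset.map_const', ← Multiset.prod_map_mul]
      exact congrArg _ (Multiset.map_congr rfl fun b _ => by ring)
    rw [h2, mul_pow, ← pow_mul, mul_comm (Multiset.card B) 2, pow_mul, neg_one_sq, one_pow, one_mul]
  -- the roots of `P` are non-zero
  have hb0 : ∀ b ∈ B, b ≠ 0 := by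
    intro b hb h0
    rw [h0, hB, mem_roots hPm.ne_zero, IsRoot.def, eval_zero_map] at hb
    apply hP0
    rw [coeff_zero_eq_eval_zero]
    exact (algebraMap ℤ ℂ).injective_int (by rw [hb, map_zero])
  -- STEP doubling: `FrobeniusMultiset.univ_val_map_eq` for the families on `B ⊕ B` and `ι ⊕ ι`
  have hident : ∀ r : ℕ, 0 < r →
      ∏ i : B ⊕ B, (1 - (Sum.elim (fun x : B => (x : ℂ)) (fun x : B => (x : ℂ)) i) ^ r) =
        ∏ j : ι ⊕ ι, (1 - (Sum.elim α α j) ^ r) := by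
    intro r hr
    rw [Fintype.prod_sum_type, Fintype.prod_sum_type]
    simp only [Sum.elim_inl, Sum.elim_inr]
    have hBprod : ∏ x : B, (1 - (x : ℂ) ^ r) = (B.map fun b => 1 - b ^ r).prod := by
      rw [Finset.prod_eq_multiset_prod, Multiset.map_univ B (fun b => 1 - b ^ r)]
    rw [hBprod, ← sq, ← sq, hsq r hr]
  have ha : ∀ i : B ⊕ B, Sum.elim (fun x : B => (x : ℂ)) (fun x : B => (x : ℂ)) i ≠ 0 := by
    rintro (x | x)
    · exact hb0 _ (Multiset.coe_mem (x := x))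
    · exact hb0 _ (Multiset.coe_mem (x := x))
  have hbc : ∀ j : ι ⊕ ι, ‖Sum.elim α α j‖ = c := by
    rintro (j | j)
    · exact hα j
    · exact hα j
  have hmult := FrobeniusMultiset.univ_val_map_eq ha hc hbc hident
  rw [univ_val_map_sum_elim, univ_val_map_sum_elim, Multiset.map_univ_coe] at hmult
  have hBA : B = (univ : Finset ι).val.map α := eq_of_add_self_eq_add_self hmult
  -- conclude
  rw [← prod_multiset_X_sub_C_of_monic_of_roots_card_eq hPm hcard', ← hB, hBA, Finset.prod_eq_multiset_prod,
    Multiset.map_map]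
  rfl

end FrobeniusRigidity

end Literature.NumberTheory.LFunctions

end
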